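import Literature.Computability.Complexity.IWStrongLanguage
import Literature.Computability.Complexity.NWQuickPRG
import Mathlib.Analysis.SpecialFunctions.Log.Basic
import Mathlib.Analysis.Asymptotics.SpecificAsymptotics
import HarnessLib

/-!
# The strong language is strongly hard on average (Impagliazzo–Wigderson 1997, Thm. 1: mild to strong)

The mild-to-strong half of Impagliazzo–Wigderson's hardness amplification inside `E`, fully proved
on top of the tree's derandomized XOR lemma (`IWAmp.exists_majority_advPred`, Hirahara 2022
Lemma 8.1 after Healy–Vadhan–Viola) in its circuit form (`IWAmpBridge.exists_circuit_of_agree`):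

* **`IWStrong.avgHard_strongLang`** — if every `B₂`-circuit of size `≤ 2^{ε₁ N/16}` errs on at least a
  `N^{-6}` fraction of `L₁ ∩ {0,1}ᴺ` for all large `N` (the output format of
  `HardLangM.exists_mildHard_E`), and `q ε₁ ≥ 64`, then for all large `n`,
  `AvgHardAtLeast ((strongLang q L₁) ∩ {0,1}ⁿ) (2^{ε'' n})` with `ε'' = IWStrong.epsOf q = 1/(3 c_q) > 0`.

Proof. At scale `t` (`n ∈ [seedLen t, seedLen (t+1))`, so `2^{ε'' n} ≤ 2ᵗ`): a circuit of size
`≤ 2ᵗ` agreeing with the slice on `≥ 1/2 + 2^{-t}` of `{0,1}ⁿ` is averaged over the ignored suffix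
(`MildHard.exists_circuit_prefix`), transported to the seeds (`card_agree_seed`), and decoded
(`exists_circuit_of_agree` with `ε = 2^{-t}`, `δ = N^{-6}`, `k = 2^{t + 6ℓ + 3}`, `C = 2^{a+1+t} N⁶`,
tables of `≤ t` bits by `card_Tsub_iwBlocks_le`) into a circuit for `L₁ ∩ {0,1}ᴺ` with fewer than
`2ᴺ/N⁶` errors and size `≤ 2^{6t + 30ℓ + 21} ≤ 2^{8t} ≤ 2^{ε₁ N/16}` (`size_le`; `ℓ = ⌊log₂ N⌋ + 1`,
`N = 2qt`), contradicting the mild hardness. The eventual inequalities in `t`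
(`eventually_log_le`, `eventually_mul_le_two_pow`, the design count for `le_length_lexWords`) are
proved from `log = o(id)` and `t = o(2ᵗ)`.

## References

* R. Impagliazzo, A. Wigderson, STOC 1997, Thm. 1 [ImpagliazzoWigderson1997].
* S. Hirahara, ECCC TR22-119, Lemma 8.1 [Hirahara2022PartialMCSP].
* S. Arora, B. Barak, *Computational Complexity: A Modern Approach*, CUP 2009, Thm. 19.27,
  Lemma 20.14 [AroraBarakCC2009].
-/

noncomputable section

namespace Literature.Computability.Complexity

open Finset Filter MetaComplexity IWAmpBridge Real

namespace IWStrong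

variable (q : ℕ)

/-! ### Eventual inequalities in the scale -/

/-- `a (⌊log₂(b t)⌋ + 1) + c ≤ t` eventually. [folklore] -/
theorem eventually_log_le (a b c : ℕ) : ∀ᶠ t : ℕ in atTop, a * (Nat.log 2 (b * t) + 1) + c ≤ t := by
  -- real form: `a (log₂ b + log₂ t + 1) + c ≤ t`, from `log = o(id)`
  have ho := Real.isLittleO_log_id_atTop
  have h1 : ∀ᶠ x : ℝ in atTop, ‖Real.log x‖ ≤ (1 / (4 * (a + 1) / Real.log 2)) * ‖x‖ :=
    ho.def (by positivity)
  have h2 : ∀ᶠ t : ℕ in atTop, ‖Real.log t‖ ≤ (1 / (4 * (a + 1) / Real.log 2)) * ‖(t : ℝ)‖ :=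
    tendsto_natCast_atTop_atTop.eventually h1
  have hl2 : 0 < Real.log 2 := Real.log_pos one_lt_two
  filter_upwards [h2, eventually_ge_atTop (2 * (a * (Nat.log 2 b + 3) + c) + 1)] with t ht ht2
  have ht1 : 1 ≤ t := by omega
  have htR : (1 : ℝ) ≤ t := by exact_mod_cast ht1
  rw [Real.norm_eq_abs, Real.norm_eq_abs, abs_of_nonneg (Real.log_nonneg htR), abs_of_nonneg (by positivity)] at ht
  -- `Nat.log 2 (b t) ≤ Nat.log 2 b + Nat.log 2 t + 1` and `Nat.log 2 t ≤ log t / log 2`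
  rcases Nat.eq_zero_or_pos b with rfl | hb
  · have : a ≤ a * (Nat.log 2 0 + 3) := Nat.le_mul_of_pos_right _ (by omega)
    simp; omega
  have hlog : Nat.log 2 (b * t) ≤ Nat.log 2 b + Nat.log 2 t + 1 := by
    have h3 : b * t < 2 ^ (Nat.log 2 b + Nat.log 2 t + 1 + 1) := by
      have hb' := Nat.lt_pow_succ_log_self one_lt_two b
      have ht' := Nat.lt_pow_succ_log_self one_lt_two t
      calc b * t < 2 ^ (Nat.log 2 b + 1) * 2 ^ (Nat.log 2 t + 1) := Nat.mul_lt_mul'' hb' ht'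
        _ = 2 ^ (Nat.log 2 b + Nat.log 2 t + 1 + 1) := by rw [← pow_add]; ring_nf
    exact Nat.lt_succ_iff.1 (Nat.log_lt_of_lt_pow (by positivity) h3 |> fun h => by omega)
  have hlt : (Nat.log 2 t : ℝ) ≤ Real.log t / Real.log 2 := by
    rw [le_div_iff₀ hl2, ← Real.log_pow]
    refine (Real.log_le_log (by positivity) ?_)
    exact_mod_cast Nat.pow_log_le_self 2 (by omega)
  -- combine in `ℝ`
  have key : (a : ℝ) * (Nat.log 2 t) ≤ t / 4 := by
    have : (a : ℝ) * (Real.log t / Real.log 2) ≤ t / 4 := by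
      rw [mul_div_assoc', div_le_iff₀ hl2]
      have := mul_le_mul_of_nonneg_left ht (show (0:ℝ) ≤ a from by positivity)
      have h4 : (a : ℝ) * (1 / (4 * (a + 1) / Real.log 2) * t) = a / (a + 1) * (Real.log 2 * t / 4) := by
        field_simp
      rw [h4] at this
      have h5 : (a : ℝ) / (a + 1) ≤ 1 := by rw [div_le_one (by positivity)]; linarith
      nlinarith [mul_le_mul_of_nonneg_right h5 (show 0 ≤ Real.log 2 * t / 4 by positivity)]
    exact le_trans (mul_le_mul_of_nonneg_left hlt (by positivity)) this
  have goalR : (a : ℝ) * (Nat.log 2 (b * t) + 1) + c ≤ t := by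
    have h6 : (Nat.log 2 (b * t) : ℝ) ≤ Nat.log 2 b + Nat.log 2 t + 1 := by exact_mod_cast hlog
    have ht2R : (2 * (a * (Nat.log 2 b + 3) + c) + 1 : ℝ) ≤ t := by exact_mod_cast ht2
    nlinarith [h6, key, show (0:ℝ) ≤ a from by positivity]
  exact_mod_cast goalR

/-- `c t ≤ 2ᵗ` eventually. [folklore] -/
theorem eventually_mul_le_two_pow (c : ℕ) : ∀ᶠ t : ℕ in atTop, c * t ≤ 2 ^ t := by
  have h := tendsto_pow_const_div_const_pow_of_one_lt 1 (one_lt_two (α := ℝ))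
  have h2 : ∀ᶠ t : ℕ in atTop, ((t : ℝ) ^ 1 / 2 ^ t) < 1 / (c + 1) := h.eventually (gt_mem_nhds (by positivity))
  filter_upwards [h2] with t ht
  rw [pow_one, div_lt_iff₀ (by positivity)] at ht
  have : (c : ℝ) * t ≤ 2 ^ t := by
    have hc : (c : ℝ) < c + 1 := by linarith
    have ht0 : (0 : ℝ) ≤ t := by positivity
    calc (c : ℝ) * t ≤ (c + 1) * t := by nlinarith
      _ ≤ (c + 1) * (1 / (c + 1) * 2 ^ t) := by nlinarith [ht, show (0:ℝ) < c + 1 by positivity]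
      _ = 2 ^ t := by field_simp
  exact_mod_cast this

/-! ### Sizes -/

/-- The length constant `c_q = 2q 2^{4q} + 16q + 11`. [folklore] -/
def cq : ℕ := 2 * q * 2 ^ (4 * q) + 16 * q + 11

/-- `seedLen t ≤ c_q (t + 1)`. [folklore] -/
theorem seedLen_le (t : ℕ) : seedLen q t ≤ cq q * (t + 1) := by
  unfold seedLen dOf mOf aOf NOf bOf cq
  have hlog : Nat.log 2 (2 * q * t) + 1 ≤ 2 * q * t + 1 := by
    have := Nat.log_le_self 2 (2 * q * t); omega
  nlinarith [hlog, Nat.zero_le (q * t), Nat.zero_le (2 ^ (4 * q)), Nat.zero_le q]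

/-- The hardness exponent `ε'' = 1/(3 c_q)`. [folklore] -/
def epsOf : ℝ := 1 / (3 * cq q)

/-- `ε'' > 0`. [folklore] -/
theorem epsOf_pos : 0 < epsOf q := by unfold epsOf cq; positivity

/-- At a length of scale `t ≥ 1`, `2^{ε'' n} ≤ 2ᵗ`. [folklore] -/
theorem two_pow_eps_le (hq : 1 ≤ q) {n t : ℕ} (ht : scaleOf q n = t) (ht1 : 1 ≤ t) : (2 : ℝ) ^ (epsOf q * n) ≤ 2 ^ (t : ℝ) := by
  have hn : n < seedLen q (t + 1) := ht ▸ lt_seedLen_scaleOf_succ q hq n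
  have hle : (n : ℝ) ≤ cq q * (t + 2) := by exact_mod_cast (hn.le.trans (seedLen_le q (t + 1))).trans (by ring_nf; omega)
  refine Real.rpow_le_rpow_of_exponent_le one_le_two ?_
  unfold epsOf
  have hc : (0 : ℝ) < cq q := by unfold cq; positivity
  rw [one_div, inv_mul_eq_div, div_le_iff₀ (by positivity)]
  have ht1R : (1 : ℝ) ≤ t := by exact_mod_cast ht1
  nlinarith

/-- The number of seeds is `2^{seedLen}`. [folklore] -/
theorem card_seed (t : ℕ) : Fintype.card (IWAmp.Seed (NOf q t) (dOf q t) (mOf q t)) = 2 ^ seedLen q t := by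
  simp only [IWAmp.Seed, Hankel.Seed, Fintype.card_prod, Fintype.card_fun, Fintype.card_bool, Fintype.card_fin, ZMod.card, seedLen]
  ring

/-! ### Transporting an attacker to the seeds -/

variable (L₁ : Language Bool)

/-- The received word on seed bits defined by a circuit on the `seedLen` prefix bits. [folklore] -/
def Gb (t : ℕ) (C' : Circuit (Fin (seedLen q t))) (s : Fin (dOf q t) ⊕ HBits (NOf q t) (mOf q t) → Bool) : Bool :=
  C'.eval fun j => s ((sidx q t).symm j)

/-- **Agreements transfer to the seeds.** [folklore] -/
theorem card_agree_seed {t : ℕ} (hdes : kOf q t ≤ (lexWords (NOf q t) (bOf q) t).length) (C' : Circuit (Fin (seedLen q t))) :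
    ((Finset.univ.filter fun σ : IWAmp.Seed (NOf q t) (dOf q t) (mOf q t) =>
        Gb q t C' (encSeed σ) = IWAmp.amp (iwBlocks (NOf q t) (bOf q) t (kOf q t) hdes) (idxOf q t) (L₁.sliceFn (NOf q t)) σ).card) =
      (Finset.univ.filter fun w' : Fin (seedLen q t) → Bool => C'.eval w' = strongFn q L₁ t w').card := by
  classical
  refine Finset.card_bij (fun σ _ => fun j => encSeed σ ((sidx q t).symm j)) (fun σ hσ => ?_) (fun σ₁ _ σ₂ _ h => ?_) (fun w' hw' => ?_)
  · rw [mem_filter] at hσ ⊢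
    refine ⟨mem_univ _, ?_⟩
    have h1 : strongFn q L₁ t (fun j => encSeed σ ((sidx q t).symm j)) =
        IWAmp.amp (iwBlocks (NOf q t) (bOf q) t (kOf q t) hdes) (idxOf q t) (L₁.sliceFn (NOf q t)) σ := by
      unfold strongFn
      rw [dif_pos hdes]
      exact congrArg _ (parseSeed_encSeed q t σ)
    rw [h1]
    exact hσ.2
  · exact encSeed_injective q t (funext fun p => by simpa using congrFun h (sidx q t p))
  · refine ⟨parseSeed q t w', ?_, ?_⟩
    · rw [mem_filter] at hw' ⊢
      refine ⟨mem_univ _, ?_⟩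
      have h2 : (fun j => encSeed (parseSeed q t w') ((sidx q t).symm j)) = w' := by
        funext j; rw [encSeed_parseSeed]; simp
      unfold Gb
      rw [h2, hw'.2]
      unfold strongFn
      rw [dif_pos hdes]
    · funext j; rw [encSeed_parseSeed]; simp

/-! ### The main estimate -/

/-- **Arithmetic of the reduction**: with `ℓ = ⌊log₂ N⌋ + 1`, `C_c = 2^{a+1+t} N⁶`, `S' ≤ 2ᵗ + 2`,
`d ≤ 2ᵗ`, the decoded circuit has size `≤ 2^{6t + 30ℓ + 21}`. [folklore] -/
theorem size_le {t N a d k Cc S' : ℕ} (ht : 1 ≤ t) (ha : a = t + 6 * (Nat.log 2 N + 1) + 3) (hk : k = 2 ^ a)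
    (hCc : Cc = 2 ^ (a + 1 + t) * N ^ 6) (hS : S' ≤ 2 ^ t + 2) (hd : d ≤ 2 ^ t) :
    (2 * Cc ^ 2 + 1) * predSize d k S' t + (9 * Cc ^ 2 + 3) ≤ 2 ^ (6 * t + 30 * (Nat.log 2 N + 1) + 21) := by
  set l := Nat.log 2 N + 1 with hl
  have hN : N < 2 ^ l := Nat.lt_pow_succ_log_self one_lt_two N
  have hN6 : N ^ 6 < 2 ^ (6 * l) := by
    calc N ^ 6 < (2 ^ l) ^ 6 := Nat.pow_lt_pow_left hN (by norm_num)
      _ = 2 ^ (6 * l) := by rw [← pow_mul, mul_comm]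
  have hCc' : Cc ≤ 2 ^ (2 * t + 12 * l + 4) := by
    rw [hCc, show 2 ^ (2 * t + 12 * l + 4) = 2 ^ (a + 1 + t) * 2 ^ (6 * l) by rw [← pow_add]; congr 1; rw [ha]; ring]
    exact Nat.mul_le_mul_left _ hN6.le
  have hC2 : Cc ^ 2 ≤ 2 ^ (4 * t + 24 * l + 8) := by
    calc Cc ^ 2 ≤ (2 ^ (2 * t + 12 * l + 4)) ^ 2 := Nat.pow_le_pow_left hCc' 2
      _ = 2 ^ (4 * t + 24 * l + 8) := by rw [← pow_mul]; ring_nf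
  have hub : univBound t ≤ 2 ^ (t + 3) := by
    have := NWMachine.univBound_add_four_le t
    have : 5 * 2 ^ t ≤ 2 ^ (t + 3) := by rw [pow_add]; norm_num; omega
    omega
  have hk' : k = 2 ^ (t + 6 * l + 3) := by rw [hk, ha]
  have hP : predSize d k S' t ≤ 2 ^ (2 * t + 6 * l + 10) := by
    unfold predSize
    have h1 : k * univBound t ≤ 2 ^ (2 * t + 6 * l + 6) := by
      rw [hk', show 2 ^ (2 * t + 6 * l + 6) = 2 ^ (t + 6 * l + 3) * 2 ^ (t + 3) by rw [← pow_add]; congr 1; ring]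
      exact Nat.mul_le_mul_left _ hub
    have h2 : k + 1 ≤ 2 ^ (t + 6 * l + 4) := by
      have hu : 1 ≤ 2 ^ (t + 6 * l + 3) := Nat.one_le_two_pow
      calc k + 1 = 2 ^ (t + 6 * l + 3) + 1 := by rw [hk']
        _ ≤ 2 ^ (t + 6 * l + 3) + 2 ^ (t + 6 * l + 3) := by omega
        _ = 2 ^ (t + 6 * l + 4) := by rw [show t + 6 * l + 4 = (t + 6 * l + 3) + 1 by ring, pow_succ]; ring
    have h3 : 2 ^ t ≤ 2 ^ (2 * t + 6 * l + 6) := Nat.pow_le_pow_right (by norm_num) (by omega)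
    have h4 : 2 ^ (t + 6 * l + 4) ≤ 2 ^ (2 * t + 6 * l + 6) := Nat.pow_le_pow_right (by norm_num) (by omega)
    have h5 : (8 : ℕ) ≤ 2 ^ (2 * t + 6 * l + 6) := by
      calc (8 : ℕ) = 2 ^ 3 := by norm_num
        _ ≤ _ := Nat.pow_le_pow_right (by norm_num) (by omega)
    have h6 : 2 ^ (2 * t + 6 * l + 10) = 16 * 2 ^ (2 * t + 6 * l + 6) := by rw [show 2 * t + 6 * l + 10 = (2 * t + 6 * l + 6) + 4 by ring, pow_add]; ring
    rw [h6]
    nlinarith [h1, h2, h3, h4, h5, hS, hd]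
  have hA : 2 * Cc ^ 2 + 1 ≤ 2 ^ (4 * t + 24 * l + 10) := by
    have : (1 : ℕ) ≤ 2 ^ (4 * t + 24 * l + 8) := Nat.one_le_two_pow
    rw [show 4 * t + 24 * l + 10 = (4 * t + 24 * l + 8) + 2 by ring, pow_add]; norm_num; nlinarith
  have hB : 9 * Cc ^ 2 + 3 ≤ 2 ^ (4 * t + 24 * l + 12) := by
    have : (1 : ℕ) ≤ 2 ^ (4 * t + 24 * l + 8) := Nat.one_le_two_pow
    rw [show 4 * t + 24 * l + 12 = (4 * t + 24 * l + 8) + 4 by ring, pow_add]; norm_num; nlinarith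
  calc (2 * Cc ^ 2 + 1) * predSize d k S' t + (9 * Cc ^ 2 + 3)
      ≤ 2 ^ (4 * t + 24 * l + 10) * 2 ^ (2 * t + 6 * l + 10) + 2 ^ (4 * t + 24 * l + 12) := by
        gcongr
    _ = 2 ^ (6 * t + 30 * l + 20) + 2 ^ (4 * t + 24 * l + 12) := by rw [← pow_add]; ring_nf
    _ ≤ 2 ^ (6 * t + 30 * l + 20) + 2 ^ (6 * t + 30 * l + 20) :=
        Nat.add_le_add_left (Nat.pow_le_pow_right (by norm_num) (by omega)) _
    _ = 2 ^ (6 * t + 30 * l + 21) := by rw [pow_succ]; ring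

/-- `predSize` is monotone in the received-word size. [folklore] -/
theorem predSize_mono {d k S S' maxT : ℕ} (h : S ≤ S') : predSize d k S maxT ≤ predSize d k S' maxT := by
  unfold predSize; omega

/-- **The strong language is strongly hard on average** (Impagliazzo–Wigderson 1997, Thm. 1, the
mild-to-strong half, via the Healy–Vadhan–Viola/Hirahara derandomized XOR lemma of the tree with
EXPONENTIALLY many blocks): if every `B₂`-circuit of size `≤ 2^{ε₁ N/16}` errs on at least a `N^{-6}`
fraction of `L₁ ∩ {0,1}ᴺ` for all large `N`, and `q ε₁ ≥ 64`, then for all large `n` every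
`B₂`-circuit of size `≤ 2^{ε'' n}` agrees with `L₂ ∩ {0,1}ⁿ` (`L₂ = strongLang q L₁`) on fewer than a
`1/2 + 2^{-ε'' n}` fraction of the inputs. [cite: ImpagliazzoWigderson1997, Thm. 1] -/
theorem avgHard_strongLang {ε₁ : ℝ} (hq : 1 ≤ q) (hqε : 64 ≤ q * ε₁)
    (hmild : ∀ᶠ N : ℕ in atTop, ∀ C : Circuit (Fin N), C.IsOver B2 → (C.size : ℝ) ≤ (2 : ℝ) ^ (ε₁ / 16 * N) →
      (2 : ℝ) ^ N ≤ (N : ℝ) ^ 6 * (Finset.univ.filter fun w : Fin N → Bool => C.eval w ≠ L₁.sliceFn N w).card) :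
    ∀ᶠ n : ℕ in atTop, AvgHardAtLeast ((strongLang q L₁).sliceFn n) ((2 : ℝ) ^ (epsOf q * n)) := by
  classical
  -- eventual facts in the scale
  have hT : Tendsto (NOf q) atTop atTop := tendsto_atTop_mono (fun t => show id t ≤ NOf q t by unfold NOf id; nlinarith) tendsto_id
  have hEv : ∀ᶠ t : ℕ in atTop, 1 ≤ t ∧ 30 * (Nat.log 2 (2 * q * t) + 1) + 21 ≤ t ∧ (2 * q * 2 ^ (4 * q)) * t ≤ 2 ^ t ∧
      ∀ C : Circuit (Fin (NOf q t)), C.IsOver B2 → (C.size : ℝ) ≤ (2 : ℝ) ^ (ε₁ / 16 * (NOf q t : ℕ)) →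
        (2 : ℝ) ^ (NOf q t) ≤ ((NOf q t : ℕ) : ℝ) ^ 6 *
          (Finset.univ.filter fun w : Fin (NOf q t) → Bool => C.eval w ≠ L₁.sliceFn (NOf q t) w).card :=
    (eventually_ge_atTop 1).and ((eventually_log_le 30 (2 * q) 21).and ((eventually_mul_le_two_pow _).and (hT.eventually hmild)))
  obtain ⟨t₀, ht₀⟩ := eventually_atTop.1 hEv
  refine eventually_atTop.2 ⟨seedLen q t₀, fun n hn => ?_⟩
  -- the scale of `n`
  set t := scaleOf q n with htdef
  have ht₀t : t₀ ≤ t := le_scaleOf_of_le q hq hn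
  obtain ⟨ht1, hE1, hE2, hmildN⟩ := ht₀ t ht₀t
  have hseed : seedLen q t ≤ n :=
    Nat.findGreatest_spec (P := fun t => seedLen q t ≤ n) ((le_seedLen q hq t₀).trans hn) hn
  set N := NOf q t with hNdef
  have hN : N = 2 * q * t := rfl
  have hNt : t + 1 ≤ N := by rw [hN]; nlinarith
  have hN1 : 1 ≤ N := by omega
  set l := Nat.log 2 N + 1 with hl
  have hl' : 30 * l + 21 ≤ t := by rw [hl, hN]; exact hE1
  -- the design words are many enough
  have hdes : kOf q t ≤ (lexWords (NOf q t) (bOf q) t).length := by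
    refine le_length_lexWords (Nat.two_pow_pos _) (by omega) ?_
    have hsplit : bOf q ^ NOf q t = bOf q ^ (NOf q t - (t + 1)) * bOf q ^ (t + 1) := by
      rw [← pow_add]; congr 1; omega
    have hk2 : kOf q t * 2 ^ NOf q t ≤ bOf q ^ (t + 1) := by
      rw [kOf, ← pow_add, bOf, ← pow_mul]
      refine Nat.pow_le_pow_right (by norm_num) ?_
      unfold aOf
      rw [← hNdef, ← hl]
      nlinarith
    rw [← mul_assoc, hsplit, mul_comm (bOf q ^ (NOf q t - (t + 1)))]
    exact Nat.mul_le_mul_right _ hk2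
  -- `d ≤ 2ᵗ`
  have hd : dOf q t ≤ 2 ^ t := by unfold dOf NOf bOf; rw [show 2 * q * t * 2 ^ (4 * q) = 2 * q * 2 ^ (4 * q) * t by ring]; exact hE2
  -- the claim
  intro C hCB hCsize
  set S : ℝ := (2 : ℝ) ^ (epsOf q * n) with hSdef
  have hSt : S ≤ (2 : ℝ) ^ (t : ℝ) := two_pow_eps_le q hq htdef.symm ht1
  have hS2t : S ≤ (2 ^ t : ℕ) := by rw [Nat.cast_pow, Nat.cast_ofNat, ← Real.rpow_natCast]; exact hSt
  have hS1 : 1 ≤ S := by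
    calc (1 : ℝ) = 2 ^ (0 : ℝ) := by simp
      _ ≤ S := Real.rpow_le_rpow_of_exponent_le one_le_two (by have := epsOf_pos q; positivity)
  have hSpos : 0 < S := by positivity
  by_contra hagr
  push Not at hagr
  -- counts on `n` bits
  have hcardn : (Fintype.card (Fin n → Bool) : ℝ) = 2 ^ n := by simp
  unfold agreement at hagr
  rw [hcardn, le_div_iff₀ (by positivity)] at hagr
  -- the slice is the strong function on the prefix
  have hslice : ∀ w : Fin n → Bool, (strongLang q L₁).sliceFn n w = strongFn q L₁ t fun j => w (Fin.castLE hseed j) :=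
    fun w => sliceFn_strongLang q L₁ htdef.symm hseed w
  -- average over the ignored suffix
  obtain ⟨C', hC'B, hC's, hC'err⟩ := MildHard.exists_circuit_prefix hseed C hCB (strongFn q L₁ t)
  have hagreeC' : (1 / 2 + 1 / S) * 2 ^ seedLen q t ≤
      ((Finset.univ.filter fun w' : Fin (seedLen q t) → Bool => C'.eval w' = strongFn q L₁ t w').card : ℝ) := by
    -- complement counts
    have hc1 := Finset.card_filter_add_card_filter_not (s := (Finset.univ : Finset (Fin (seedLen q t) → Bool)))
      (fun w' => C'.eval w' = strongFn q L₁ t w')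
    have hc2 := Finset.card_filter_add_card_filter_not (s := (Finset.univ : Finset (Fin n → Bool)))
      (fun w => C.eval w = (strongLang q L₁).sliceFn n w)
    simp only [card_univ, Fintype.card_fun, Fintype.card_bool, Fintype.card_fin] at hc1 hc2
    have herrR : ((Finset.univ.filter fun w' : Fin (seedLen q t) → Bool => ¬C'.eval w' = strongFn q L₁ t w').card : ℝ) * 2 ^ (n - seedLen q t) ≤
        ((Finset.univ.filter fun w : Fin n → Bool => ¬C.eval w = (strongLang q L₁).sliceFn n w).card : ℝ) := by
      have := hC'err
      simp only [ne_eq, hslice] at this ⊢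
      exact_mod_cast this
    have hpow : (2 : ℝ) ^ n = 2 ^ seedLen q t * 2 ^ (n - seedLen q t) := by
      rw [← pow_add, Nat.add_sub_cancel' hseed]
    have hc1R : ((Finset.univ.filter fun w' : Fin (seedLen q t) → Bool => C'.eval w' = strongFn q L₁ t w').card : ℝ) +
        ((Finset.univ.filter fun w' : Fin (seedLen q t) → Bool => ¬C'.eval w' = strongFn q L₁ t w').card : ℝ) = 2 ^ seedLen q t := by
      exact_mod_cast hc1
    have hc2R : ((Finset.univ.filter fun w : Fin n → Bool => C.eval w = (strongLang q L₁).sliceFn n w).card : ℝ) +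
        ((Finset.univ.filter fun w : Fin n → Bool => ¬C.eval w = (strongLang q L₁).sliceFn n w).card : ℝ) = 2 ^ n := by
      exact_mod_cast hc2
    have h2pos : (0 : ℝ) < 2 ^ (n - seedLen q t) := by positivity
    -- `agree' · 2^{n-len} = 2^n - err' · 2^{n-len} ≥ 2^n - errC = agreeC ≥ (1/2 + 1/S) 2^n`
    have e1 : ((Finset.univ.filter fun w' : Fin (seedLen q t) → Bool => C'.eval w' = strongFn q L₁ t w').card : ℝ) * 2 ^ (n - seedLen q t) =
        2 ^ n - ((Finset.univ.filter fun w' : Fin (seedLen q t) → Bool => ¬C'.eval w' = strongFn q L₁ t w').card : ℝ) * 2 ^ (n - seedLen q t) := by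
      rw [hpow, ← hc1R]; ring
    have key : (1 / 2 + 1 / S) * 2 ^ seedLen q t * 2 ^ (n - seedLen q t) ≤
        ((Finset.univ.filter fun w' : Fin (seedLen q t) → Bool => C'.eval w' = strongFn q L₁ t w').card : ℝ) * 2 ^ (n - seedLen q t) := by
      rw [mul_assoc, ← hpow, e1]
      linarith
    exact le_of_mul_le_mul_right key h2pos
  -- to the seeds
  have hG : CktSize B2 (fun s (_ : Unit) => Gb q t C' s) C'.size := (C'.cktSize_eval hC'B).rewire fun j => (sidx q t).symm j
  set ε : ℝ := 1 / 2 ^ t with hεdef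
  have hε : 0 < ε := by positivity
  have hεS : ε ≤ 1 / S := by
    rw [hεdef]; exact one_div_le_one_div_of_le hSpos (by exact_mod_cast hS2t)
  have hagree : (1 / 2 + ε) * Fintype.card (IWAmp.Seed (NOf q t) (dOf q t) (mOf q t)) ≤
      ((Finset.univ.filter fun σ : IWAmp.Seed (NOf q t) (dOf q t) (mOf q t) =>
        Gb q t C' (encSeed σ) = IWAmp.amp (iwBlocks (NOf q t) (bOf q) t (kOf q t) hdes) (idxOf q t) (L₁.sliceFn (NOf q t)) σ).card : ℝ) := by
    rw [card_agree_seed q L₁ hdes C', card_seed]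
    push_cast
    nlinarith [hagreeC', show (0 : ℝ) ≤ 2 ^ seedLen q t by positivity]
  -- parameters of the decoding
  set δ : ℝ := 1 / (N : ℝ) ^ 6 with hδdef
  have hNpos : (0 : ℝ) < N := by exact_mod_cast hN1
  have hδ : 0 < δ := by positivity
  have hNl : (N : ℝ) ^ 6 < 2 ^ (6 * l) := by
    have : N ^ 6 < 2 ^ (6 * l) := by
      calc N ^ 6 < (2 ^ l) ^ 6 := Nat.pow_lt_pow_left (Nat.lt_pow_succ_log_self one_lt_two N) (by norm_num)
        _ = 2 ^ (6 * l) := by rw [← pow_mul, mul_comm]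
    exact_mod_cast this
  have hkR : (kOf q t : ℝ) = 2 ^ t * 2 ^ (6 * l) * 8 := by
    unfold kOf aOf; rw [← hNdef, ← hl]; push_cast; rw [pow_add, pow_add, pow_mul]; norm_num
  have hkεδ : 6 ≤ (kOf q t : ℝ) * ε * δ := by
    rw [hkR, hεdef, hδdef]
    have h2t : (0 : ℝ) < 2 ^ t := by positivity
    rw [show (2 : ℝ) ^ t * 2 ^ (6 * l) * 8 * (1 / 2 ^ t) * (1 / (N : ℝ) ^ 6) = 8 * (2 ^ (6 * l) / (N : ℝ) ^ 6) by field_simp]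
    have : 1 ≤ (2 : ℝ) ^ (6 * l) / (N : ℝ) ^ 6 := by rw [le_div_iff₀ (by positivity)]; linarith
    linarith
  obtain ⟨Cc, hCcdef⟩ : ∃ Cc : ℕ, Cc = 2 ^ (aOf q t + 1 + t) * N ^ 6 := ⟨_, rfl⟩
  have hCεδ : 2 * (kOf q t : ℝ) ≤ (Cc : ℝ) * ε * δ := by
    rw [hCcdef, hεdef, hδdef, kOf]
    push_cast
    rw [show (2 : ℝ) ^ (aOf q t + 1 + t) * (N : ℝ) ^ 6 * (1 / 2 ^ t) * (1 / (N : ℝ) ^ 6) = 2 ^ (aOf q t + 1) by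
      rw [pow_add]; field_simp]
    rw [pow_succ]; linarith
  -- decode
  obtain ⟨K, hKB, hKs, hKerr⟩ := exists_circuit_of_agree (iwBlocks (NOf q t) (bOf q) t (kOf q t) hdes) (idxOf q t)
    (idxOf_injective q t) (L₁.sliceFn (NOf q t)) hε hδ hkεδ hCεδ (card_Tsub_iwBlocks_le hdes) (Gb q t C') hG hagree
  -- size of the decoded circuit
  have hCnat : C.size ≤ 2 ^ t := by
    have : (C.size : ℝ) ≤ (2 ^ t : ℕ) := hCsize.trans hS2t
    exact_mod_cast this
  have hKsize : K.size ≤ 2 ^ (8 * t) := by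
    refine hKs.trans ((Nat.add_le_add_right (Nat.mul_le_mul_left _ (predSize_mono (hC's.trans (Nat.add_le_add_right hCnat 2)))) _).trans ?_)
    refine (size_le ht1 rfl rfl hCcdef le_rfl hd).trans (Nat.pow_le_pow_right (by norm_num) ?_)
    rw [← hl]; omega
  have hKsizeR : (K.size : ℝ) ≤ (2 : ℝ) ^ (ε₁ / 16 * (NOf q t : ℕ)) := by
    have h1 : (K.size : ℝ) ≤ 2 ^ ((8 * t : ℕ) : ℝ) := by rw [Real.rpow_natCast]; exact_mod_cast hKsize
    refine h1.trans (Real.rpow_le_rpow_of_exponent_le one_le_two ?_)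
    rw [← hNdef, hN]; push_cast
    have ht0 : (0 : ℝ) ≤ t := by positivity
    have h2 : ε₁ / 16 * (2 * (q : ℝ) * t) = (q * ε₁) * t / 8 := by ring
    rw [h2]
    have h3 := mul_le_mul_of_nonneg_right hqε ht0
    linarith
  -- contradiction with the mild hardness at `N`
  have hm := hmildN K hKB hKsizeR
  have hcardN : (Fintype.card (Fin N → Bool) : ℝ) = 2 ^ N := by simp
  have herr : ((Finset.univ.filter fun v : Fin N → Bool => K.eval v ≠ L₁.sliceFn N v).card : ℝ) < δ * 2 ^ N := hKerr
  rw [hδdef] at herr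
  have hN6 : (0 : ℝ) < (N : ℝ) ^ 6 := by positivity
  have h7 : (N : ℝ) ^ 6 * ((Finset.univ.filter fun v : Fin N → Bool => K.eval v ≠ L₁.sliceFn N v).card : ℝ) < 2 ^ N := by
    calc (N : ℝ) ^ 6 * ((Finset.univ.filter fun v : Fin N → Bool => K.eval v ≠ L₁.sliceFn N v).card : ℝ)
        < (N : ℝ) ^ 6 * (1 / (N : ℝ) ^ 6 * 2 ^ N) := mul_lt_mul_of_pos_left herr hN6
      _ = 2 ^ N := by field_simp
  linarith

end IWStrong

end Literature.Computability.Complexity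

end
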